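import Summits.QuantumFields.YangMills.Theorems.DiagonalMirrorRPRWilsonDiagonalModelShiftedBlockChain
import Literature.Analysis.OperatorTheory.SlabFibreContraction

/-!
# Crux `WeakCouplingHypercubicLimitRP` (stmt-QuantumFields-27398) / aside `DiagonalMirrorRPR` (stmt-QuantumFields-10604), door B, R1-side
# supply chain of D1′ (`stub_oddTorusSwapPairingLiminf`), item (ii) step 2: contraction of the two block interiors — the TWO-INSERTION
# cyclic layout `Xᵀ_f, 𝔟, …, 𝔟, X_g, 𝔟, …, 𝔟` of `Literature/…/HeterogeneousCyclicPeeling.integral_cyclic_insert_two`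

Helper file (`--supports stmt-QuantumFields-27398 --as helper`) of the hand `hand-10604-wilsonDiagModel-2` g3 (docket director-ym g24, O4 WORD 47 (2) /
48 (1): item (ii)); it closes nothing by itself.

WHAT.  `…ShiftedBlockChain.integral_obsL_mul_obsR_shift_mul_pairChain_eq` wrote `∫ Θf · g(·+s) · (pair chain)` on `ℤ/mℤ` as the integral over
lifted sites `V : ℤ/mℤ → ℕ × HalfCfg` (finite measure `μ̃`) of (gap `𝔟`-chain) · (far `𝔟`-chain) · `halfBlock f (V_0, V_{−1}, …, V_{−e−1})` ·
`halfBlock g (V_s, …, V_{s+e+1})`.  Here, for `s = a + 2`, far arc `n = b' + 2` (so `m = 2e + a + b' + 6`), the two block INTERIORS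
`V_{−1} … V_{−e}` and `V_{s+1} … V_{s+e}` are integrated out (Fubini on the finite measure `μ̃`; they assemble hand-2's transported half observables
`halfBlockT f (V_0) (V_{−e−1})` and `halfBlockT g (V_s) (V_{s+e+1})`, `…OpenLink`), and the remaining `a + b' + 6` sites are relabelled into the cycle
`Fin (1 + (a + 2 + (b' + 1 + 1)) + 1)` starting at `V_{−e−1}`:
* ★★ **`integral_obsL_mul_obsR_shift_mul_pairChain_eq_insertTwo`**:
  `∫ Θf · g(· + (a+2)) · ∏_t e^{β even_t} e^{β odd_t} dP = ∫ ∏_t κ_t(V t, V (t+1)) dμ̃^{⊗ Fin (a+b'+6)}(V)` with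
  `κ_0 = Xᵀ_f` (`Xᵀ_f(x, y) = halfBlockT f y x`, the REVERSED half block — the left observable is the swap reflection `Θf`),
  `κ_{a+3} = X_g = halfBlockT g`, and `κ_t = 𝔟` (hand-1's reweighted lifted kernel) otherwise — LITERALLY the left-hand side of
  `integral_cyclic_insert_two (X := Xᵀ_f) (X' := X_g) (K := 𝔟) (a + 2) (b' + 1)`, i.e. the path-space form of `Tr(𝒯_f^† 𝔅^{a+2} 𝒯_g 𝔅^{b'+2})`.
The bookkeeping (labelling of windows and interiors by `ℕ`-casts into `ℤ/mℤ`, Fubini outer/inner, the heterogeneous bond product on the outer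
cycle) follows `Literature/…/SlabFibreContraction.slab_cyclic_two` (whose hypotheses — probability site measure, non-negative bond weight — the
signed open links of the feature lift do not meet; hence this bespoke instance).

HONEST FRAMING: bookkeeping of the pairing layer for a shifted observable; no letter is proved; D1′, ⟨27398⟩ (0∕2), S6i and the aside ⟨10604⟩ are
OPEN; nothing here bears on the summit; the Yang–Mills mass gap is NOT proved here or anywhere in the tree.  No definition, no instance, no
notation, `autoImplicit false`.

References: K. Osterwalder, E. Seiler, Ann. Phys. 110 (1978) §2–3; E. Seiler, LNP 159 (1982) Ch. 2; B. Simon, *Trace Ideals* (2005) Ch. 3.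
-/

set_option autoImplicit false

noncomputable section

open scoped BigOperators ENNReal
open MeasureTheory Function
open Literature.MathematicalPhysics.QuantumLattice Literature.MathematicalPhysics.QuantumFieldTheory
open Literature.Analysis.OperatorTheory (slab_zmod_equiv slab_integral_pi_split slab_integral_pi_two_blocks)
open Summit.QuantumFields.YangMills.Cruxes.DiagonalMirrorRPR.ParityBridgeColdTraces

namespace Summit.QuantumFields.YangMills.Cruxes.DiagonalMirrorRPR.SignTwistedDiagonalTrace.WilsonDiagonal

section ShiftedSandwich

variable {S : ℕ} [NeZero S] {G : Type} [Group G] {Nc : ℕ} (ρ : G →* Matrix (Fin Nc) (Fin Nc) ℂ)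
variable [TopologicalSpace G] [IsTopologicalGroup G] [CompactSpace G] [MeasurableSpace G] [BorelSpace G]
  [SecondCountableTopology G]

/-- `ℕ`-casts into `ℤ/mℤ` of complementary naturals are opposite: `p + q = m ⇒ (p : ℤ/m) = −(q : ℤ/m)`. -/
theorem natCast_zmod_eq_neg_of_add_eq {m p q : ℕ} (h : p + q = m) : ((p : ℕ) : ZMod m) = -((q : ℕ) : ZMod m) := by
  rw [eq_neg_iff_add_eq_zero, ← Nat.cast_add, h, ZMod.natCast_self]

/-- ★★ **The two-insertion cyclic layout** (`β ≥ 0`, `ρ` continuous unitary, `|w(Y)_j| ≤ M`, `m = 2e + a + b' + 6`, observables `f, g` of depth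
`e + 1`, bounded measurable; `g` read on the string shifted by `a + 2`):
`∫ Θf(P) · g(P(· + (a+2))) · ∏_t e^{β even_t} e^{β odd_t} dP = ∫ ∏_{t : Fin (a+b'+6)} κ_t(V t, V (t+1)) dμ̃^{⊗}(V)`, `κ_0 = Xᵀ_f`, `κ_{a+3} = X_g`,
`κ_t = 𝔟` otherwise — the left-hand side of `integral_cyclic_insert_two (a + 2) (b' + 1)`. -/
theorem integral_obsL_mul_obsR_shift_mul_pairChain_eq_insertTwo (hρ : Continuous ρ) {β : ℝ} (hβ : 0 ≤ β)
    (hρu : ∀ g, ρ g ∈ Matrix.unitaryGroup (Fin Nc) ℂ) {M : ℝ}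
    (hM : ∀ (Y : HalfCfg S S G) (j : Fin (featDim S Nc)), |bondVec ρ Y j| ≤ M) {m a b' e : ℕ} [NeZero m]
    (hm : m = 2 * e + a + b' + 6) {f g : (Fin (e + 1) → HalfCfg S S G) → (Fin (e + 1) → HalfCfg S S G) → ℝ}
    (hf : Measurable (uncurry f)) (hg : Measurable (uncurry g)) {B : ℝ} (hBf : ∀ Y X, |f Y X| ≤ B) (hBg : ∀ Y X, |g Y X| ≤ B) :
    ∫ P : ZMod m → HalfCfg S S G × HalfCfg S S G,
        obsL f P * obsR g (fun t => P (t + (((a + 2 : ℕ)) : ZMod m))) *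
          ∏ t : ZMod m, Real.exp (β * evenActionU ρ (P t).1 (P t).2 (P (t + 1)).1) *
            Real.exp (β * oddActionU ρ (P t).2 (P (t + 1)).1 (P (t + 1)).2)
        ∂(Measure.pi fun _ : ZMod m => (halfHaar S G).prod (halfHaar S G)) =
      ∫ V : Fin (1 + (a + 2 + (b' + 1 + 1)) + 1) → ℕ × HalfCfg S S G, ∏ t : Fin (1 + (a + 2 + (b' + 1 + 1)) + 1),
        (fun i : ℕ => if i = 0 then (fun x y : ℕ × HalfCfg S S G => halfBlockT S G Nc ρ β M f y x)
          else if i = a + 2 + 1 then halfBlockT S G Nc ρ β M g else bKernel ρ β M) (t : ℕ) (V t) (V (t + 1))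
        ∂(Measure.pi fun _ => tMeasure S G Nc β M) := by
  haveI := isFiniteMeasure_tMeasure (S := S) (G := G) (Nc := Nc) hβ M
  rw [integral_obsL_mul_obsR_shift_mul_pairChain_eq ρ hρ hβ hρu hM (s := a + 2) (n := b' + 2) (e := e) (by omega) hf hg hBf hBg]
  -- bounds and measurability of the pieces
  obtain ⟨Cb, hCb⟩ := exists_abs_bKernel_le ρ hρ β hM
  obtain ⟨C, hC0, hC⟩ := exists_abs_openLink_le ρ hρ β hM
  have hB0 : 0 ≤ B := (abs_nonneg _).trans (hBf (fun _ _ => 1) (fun _ _ => 1))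
  have hCb0 : 0 ≤ Cb := (norm_nonneg _).trans (hCb ((0 : ℕ), fun _ => 1) ((0 : ℕ), fun _ => 1))
  have hHfb : ∀ v, |halfBlock ρ β M f v| ≤ C ^ (e + 1) * B := abs_halfBlock_le ρ β M hC0.le hC hBf
  have hHgb : ∀ v, |halfBlock ρ β M g v| ≤ C ^ (e + 1) * B := abs_halfBlock_le ρ β M hC0.le hC hBg
  have hHfm : Measurable (halfBlock ρ β M f) := measurable_halfBlock ρ hρ β M hf
  have hHgm : Measurable (halfBlock ρ β M g) := measurable_halfBlock ρ hρ β M hg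
  have hbm : Measurable fun q : (ℕ × HalfCfg S S G) × (ℕ × HalfCfg S S G) => bKernel ρ β M q.1 q.2 :=
    (stronglyMeasurable_bKernel (S := S) ρ hρ β M).measurable
  -- the integrand over `ℤ/mℤ`-indexed sites
  set F : (ZMod m → ℕ × HalfCfg S S G) → ℝ := fun V =>
    (∏ j : Fin (a + 2), bKernel ρ β M (V (((j : ℕ) : ℕ) : ZMod m)) (V ((((j : ℕ) + 1 : ℕ)) : ZMod m))) *
      (∏ j : Fin (b' + 2), bKernel ρ β M (V ((a + 2 + e + 1 + (j : ℕ) : ℕ) : ZMod m)) (V ((a + 2 + e + 2 + (j : ℕ) : ℕ) : ZMod m))) *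
      (halfBlock ρ β M f (fun j : Fin (e + 2) => V (-(((j : ℕ) : ℕ) : ZMod m))) *
        halfBlock ρ β M g (fun j : Fin (e + 2) => V ((a + 2 + (j : ℕ) : ℕ) : ZMod m))) with hF
  have hb' : ∀ c d : ZMod m, Measurable fun V : ZMod m → ℕ × HalfCfg S S G => bKernel ρ β M (V c) (V d) := fun c d => by
    have h := hbm.comp ((measurable_pi_apply c).prodMk (measurable_pi_apply d) :
      Measurable fun V : ZMod m → ℕ × HalfCfg S S G => (V c, V d))
    simpa only [Function.comp_def] using h
  have hH' : ∀ {h : (Fin (e + 1) → HalfCfg S S G) → (Fin (e + 1) → HalfCfg S S G) → ℝ}, Measurable (halfBlock ρ β M h) →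
      ∀ c : Fin (e + 2) → ZMod m, Measurable fun V : ZMod m → ℕ × HalfCfg S S G => halfBlock ρ β M h (fun k => V (c k)) :=
    fun hHm c => by
    have h := hHm.comp (measurable_pi_lambda _ fun k => measurable_pi_apply (c k) :
      Measurable fun V : ZMod m → ℕ × HalfCfg S S G => fun k => V (c k))
    simpa only [Function.comp_def] using h
  have hFm : Measurable F :=
    ((Finset.measurable_prod _ fun j _ => hb' _ _).mul (Finset.measurable_prod _ fun j _ => hb' _ _)).mul
      ((hH' hHfm fun k => -(((k : ℕ) : ℕ) : ZMod m)).mul (hH' hHgm fun k => ((a + 2 + (k : ℕ) : ℕ) : ZMod m)))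
  have hFb : ∀ V, ‖F V‖ ≤ Cb ^ (a + 2) * Cb ^ (b' + 2) * ((C ^ (e + 1) * B) * (C ^ (e + 1) * B)) := fun V => by
    simp only [hF]
    rw [Real.norm_eq_abs, abs_mul, abs_mul, abs_mul, Finset.abs_prod, Finset.abs_prod]
    refine mul_le_mul (mul_le_mul ?_ ?_ (by positivity) (by positivity))
      (mul_le_mul (hHfb _) (hHgb _) (abs_nonneg _) (by positivity)) (by positivity) (by positivity)
    · calc ∏ j : Fin (a + 2), |bKernel ρ β M (V (((j : ℕ) : ℕ) : ZMod m)) (V ((((j : ℕ) + 1 : ℕ)) : ZMod m))| ≤ ∏ _j : Fin (a + 2), Cb :=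
            Finset.prod_le_prod (fun j _ => abs_nonneg _) fun j _ => by simpa only [Real.norm_eq_abs] using hCb _ _
        _ = Cb ^ (a + 2) := by rw [Finset.prod_const, Finset.card_univ, Fintype.card_fin]
    · calc ∏ j : Fin (b' + 2), |bKernel ρ β M (V ((a + 2 + e + 1 + (j : ℕ) : ℕ) : ZMod m)) (V ((a + 2 + e + 2 + (j : ℕ) : ℕ) : ZMod m))|
          ≤ ∏ _j : Fin (b' + 2), Cb :=
            Finset.prod_le_prod (fun j _ => abs_nonneg _) fun j _ => by simpa only [Real.norm_eq_abs] using hCb _ _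
        _ = Cb ^ (b' + 2) := by rw [Finset.prod_const, Finset.card_univ, Fintype.card_fin]
  -- the outer cycle `Fin NN`, `NN = a + b' + 6`: marked bonds `0` (reversed block of `f`) and `c3 = a + 3` (block of `g`)
  obtain ⟨c3, hvc3⟩ : ∃ c3 : Fin (1 + (a + 2 + (b' + 1 + 1)) + 1), (c3 : ℕ) = a + 2 + 1 := ⟨⟨a + 2 + 1, by omega⟩, rfl⟩
  have hvc4 : ((c3 + 1 : Fin (1 + (a + 2 + (b' + 1 + 1)) + 1)) : ℕ) = a + 2 + 1 + 1 := by
    rw [Fin.val_add_one, if_neg, hvc3]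
    intro h
    have := congrArg Fin.val h
    rw [hvc3, Fin.val_last] at this
    omega
  have hv1 : ((1 : Fin (1 + (a + 2 + (b' + 1 + 1)) + 1)) : ℕ) = 1 := by
    rw [Fin.val_one', Nat.mod_eq_of_lt (by omega)]
  have hmem : ∀ x : Fin (1 + (a + 2 + (b' + 1 + 1)) + 1),
      x ∈ ({0, c3} : Finset (Fin (1 + (a + 2 + (b' + 1 + 1)) + 1))) ↔ (x : ℕ) = 0 ∨ (x : ℕ) = a + 2 + 1 := by
    intro x
    rw [Finset.mem_insert, Finset.mem_singleton, Fin.ext_iff, Fin.ext_iff, Fin.val_zero, hvc3]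
  have h0c3 : (0 : Fin (1 + (a + 2 + (b' + 1 + 1)) + 1)) ≠ c3 := by
    intro h
    have := congrArg Fin.val h
    rw [Fin.val_zero, hvc3] at this
    omega
  have hcardC : Fintype.card {t : Fin (1 + (a + 2 + (b' + 1 + 1)) + 1) // ¬((t : ℕ) = 0 ∨ (t : ℕ) = a + 2 + 1)} =
      1 + (a + 2 + (b' + 1 + 1)) + 1 - 2 := by
    rw [Fintype.card_subtype_compl, Fintype.card_fin,
      Fintype.card_of_subtype ({0, c3} : Finset (Fin (1 + (a + 2 + (b' + 1 + 1)) + 1))) hmem, Finset.card_pair h0c3]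
  -- labelling of the sites: window `Fin NN` (t = 0 ↦ V_{-e-1}; 1 ≤ t ≤ a+3 ↦ V_{t-1}; t ≥ a+4 ↦ V_{t+e-1}), left interior
  -- `k ↦ V_{-k-1}`, right interior `k ↦ V_{a+3+k}`, by `ℕ`-labels below `m` cast into `ℤ/mℤ`
  set lab : Fin (1 + (a + 2 + (b' + 1 + 1)) + 1) ⊕ (Fin e ⊕ Fin e) → ℕ := Sum.elim
      (fun t => if (t : ℕ) = 0 then m - e - 1 else if (t : ℕ) ≤ a + 3 then (t : ℕ) - 1 else (t : ℕ) + e - 1)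
      (Sum.elim (fun k : Fin e => m - 1 - (k : ℕ)) (fun k : Fin e => a + 3 + (k : ℕ))) with hlab
  obtain ⟨es, hes⟩ := slab_zmod_equiv (N := m) lab
    (by
      rintro (t | k | k)
      · simp only [hlab, Sum.elim_inl]; have := t.isLt; split_ifs <;> (first | contradiction | omega)
      · simp only [hlab, Sum.elim_inr, Sum.elim_inl]; have := k.isLt; omega
      · simp only [hlab, Sum.elim_inr]; have := k.isLt; omega)
    (by
      rintro (t | k | k) (t' | k' | k') h <;> simp only [hlab, Sum.elim_inl, Sum.elim_inr] at h
      · refine congrArg Sum.inl (Fin.ext ?_); have := t.isLt; have := t'.isLt; split_ifs at h <;> omega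
      · exfalso; have := t.isLt; have := k'.isLt; split_ifs at h <;> omega
      · exfalso; have := t.isLt; have := k'.isLt; split_ifs at h <;> omega
      · exfalso; have := t'.isLt; have := k.isLt; split_ifs at h <;> omega
      · exact congrArg Sum.inr (congrArg Sum.inl (Fin.ext (by have := k.isLt; have := k'.isLt; omega)))
      · exfalso; have := k.isLt; have := k'.isLt; omega
      · exfalso; have := t'.isLt; have := k.isLt; split_ifs at h <;> omega
      · exfalso; have := k.isLt; have := k'.isLt; omega
      · exact congrArg Sum.inr (congrArg Sum.inr (Fin.ext (by omega))))
    (by simp only [Fintype.card_sum, Fintype.card_fin]; omega)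
  -- Fubini: outer cycle versus the two interiors
  refine (slab_integral_pi_split (tMeasure S G Nc β M) es hFm hFb).trans ?_
  refine integral_congr_ae (ae_of_all _ fun W => ?_)
  dsimp only
  -- identification of the sites of the joined configuration
  have hev : ∀ (v : Fin e ⊕ Fin e → ℕ × HalfCfg S S G) (x : Fin (1 + (a + 2 + (b' + 1 + 1)) + 1) ⊕ (Fin e ⊕ Fin e)) (l : ℕ),
      lab x = l → Sum.elim W v (es.symm ((l : ℕ) : ZMod m)) = Sum.elim W v x := by
    intro v x l h
    have hx : es.symm ((l : ℕ) : ZMod m) = x := by rw [Equiv.symm_apply_eq, hes, h]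
    rw [hx]
  -- gap sites `V_j = W_{j+1}`, `j ≤ a + 3`
  have hgap : ∀ (v : Fin e ⊕ Fin e → ℕ × HalfCfg S S G) (j : ℕ) (hj : j ≤ a + 2),
      Sum.elim W v (es.symm ((j : ℕ) : ZMod m)) = W ⟨j + 1, by omega⟩ := fun v j hj =>
    hev v (Sum.inl ⟨j + 1, by omega⟩) j (by rw [hlab, Sum.elim_inl, Fin.val_mk]; split_ifs <;> (first | contradiction | omega))
  -- far-arc sites `V_{a+e+3+j} = W_{a+4+j}`, `j ≤ b' + 1`
  have hfar : ∀ (v : Fin e ⊕ Fin e → ℕ × HalfCfg S S G) (j : ℕ) (hj : j ≤ b' + 1),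
      Sum.elim W v (es.symm ((a + 2 + e + 1 + j : ℕ) : ZMod m)) = W ⟨a + 4 + j, by omega⟩ := fun v j hj =>
    hev v (Sum.inl ⟨a + 4 + j, by omega⟩) _ (by rw [hlab, Sum.elim_inl, Fin.val_mk]; split_ifs <;> (first | contradiction | omega))
  have hfar' : ∀ (v : Fin e ⊕ Fin e → ℕ × HalfCfg S S G) (j : Fin (b' + 2)),
      Sum.elim W v (es.symm ((a + 2 + e + 2 + (j : ℕ) : ℕ) : ZMod m)) = W ((⟨a + 4 + (j : ℕ), by omega⟩ : Fin _) + 1) := by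
    intro v j
    obtain ⟨t4, ht4⟩ : ∃ t4 : Fin (1 + (a + 2 + (b' + 1 + 1)) + 1), (t4 : ℕ) = a + 4 + (j : ℕ) :=
      ⟨⟨a + 4 + (j : ℕ), by omega⟩, rfl⟩
    have ht4' : (⟨a + 4 + (j : ℕ), by omega⟩ : Fin (1 + (a + 2 + (b' + 1 + 1)) + 1)) = t4 := Fin.ext (by rw [ht4])
    rw [ht4']
    by_cases hj : (j : ℕ) = b' + 1
    · have hl : t4 = Fin.last (1 + (a + 2 + (b' + 1 + 1))) := Fin.ext (by rw [ht4, Fin.val_last]; omega)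
      rw [hl, Fin.last_add_one]
      exact hev v (Sum.inl 0) _ (by rw [hlab, Sum.elim_inl, Fin.val_zero]; split_ifs <;> (first | contradiction | omega))
    · have hlt : t4 < Fin.last (1 + (a + 2 + (b' + 1 + 1))) :=
        Fin.lt_def.2 (by rw [ht4, Fin.val_last]; have := j.isLt; omega)
      exact hev v (Sum.inl (t4 + 1)) _ (by rw [hlab, Sum.elim_inl, Fin.val_add_one_of_lt hlt, ht4]; split_ifs <;> (first | contradiction | omega))
  -- the reflected block `(V_0, V_{-1}, …, V_{-e-1}) = W_1 ∷ v_L :: W_0`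
  have hvL : ∀ v : Fin e ⊕ Fin e → ℕ × HalfCfg S S G,
      (fun j : Fin (e + 2) => Sum.elim W v (es.symm (-(((j : ℕ) : ℕ) : ZMod m)))) =
        Fin.cons (W 1) (Fin.snoc (fun k => v (Sum.inl k)) (W 0)) := by
    intro v
    funext j
    refine Fin.cases ?_ (fun j' => ?_) j
    · have h0 : (-((((0 : Fin (e + 2)) : ℕ) : ℕ) : ZMod m)) = ((0 : ℕ) : ZMod m) := by
        rw [Fin.val_zero, Nat.cast_zero, neg_zero]
      rw [Fin.cons_zero, h0]
      exact hev v (Sum.inl 1) 0 (by rw [hlab, Sum.elim_inl, hv1]; split_ifs <;> (first | contradiction | omega))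
    · rw [Fin.cons_succ]
      refine Fin.lastCases ?_ (fun k => ?_) j'
      · rw [Fin.snoc_last, Fin.val_succ, Fin.val_last, ← natCast_zmod_eq_neg_of_add_eq (p := m - e - 1) (q := e + 1) (by omega)]
        exact hev v (Sum.inl 0) _ (by rw [hlab, Sum.elim_inl, Fin.val_zero]; split_ifs <;> (first | contradiction | omega))
      · rw [Fin.snoc_castSucc, Fin.val_succ, Fin.val_castSucc,
          ← natCast_zmod_eq_neg_of_add_eq (p := m - 1 - (k : ℕ)) (q := (k : ℕ) + 1) (by omega)]
        exact hev v (Sum.inr (Sum.inl k)) _ (by rw [hlab, Sum.elim_inr, Sum.elim_inl])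
  -- the direct block `(V_{a+2}, …, V_{a+e+3}) = W_{c3} ∷ v_R :: W_{c3+1}`
  have hvR : ∀ v : Fin e ⊕ Fin e → ℕ × HalfCfg S S G,
      (fun j : Fin (e + 2) => Sum.elim W v (es.symm ((a + 2 + (j : ℕ) : ℕ) : ZMod m))) =
        Fin.cons (W c3) (Fin.snoc (fun k => v (Sum.inr k)) (W (c3 + 1))) := by
    intro v
    funext j
    refine Fin.cases ?_ (fun j' => ?_) j
    · rw [Fin.cons_zero, Fin.val_zero]
      exact hev v (Sum.inl c3) _ (by rw [hlab, Sum.elim_inl, hvc3]; split_ifs <;> (first | contradiction | omega))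
    · rw [Fin.cons_succ]
      refine Fin.lastCases ?_ (fun k => ?_) j'
      · rw [Fin.snoc_last, Fin.val_succ, Fin.val_last]
        exact hev v (Sum.inl (c3 + 1)) _ (by rw [hlab, Sum.elim_inl, hvc4]; split_ifs <;> (first | contradiction | omega))
      · rw [Fin.snoc_castSucc, Fin.val_succ, Fin.val_castSucc]
        exact hev v (Sum.inr (Sum.inr k)) _ (by rw [hlab, Sum.elim_inr, Sum.elim_inr]; omega)
  -- the free bonds: gap and far arc together are the bonds of the outer cycle other than `0` and `c3`
  have hfree : ∀ v : Fin e ⊕ Fin e → ℕ × HalfCfg S S G,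
      (∏ j : Fin (a + 2), bKernel ρ β M (Sum.elim W v (es.symm (((j : ℕ) : ℕ) : ZMod m)))
          (Sum.elim W v (es.symm ((((j : ℕ) + 1 : ℕ)) : ZMod m)))) *
        (∏ j : Fin (b' + 2), bKernel ρ β M (Sum.elim W v (es.symm ((a + 2 + e + 1 + (j : ℕ) : ℕ) : ZMod m)))
          (Sum.elim W v (es.symm ((a + 2 + e + 2 + (j : ℕ) : ℕ) : ZMod m)))) =
        ∏ t : {t : Fin (1 + (a + 2 + (b' + 1 + 1)) + 1) // ¬((t : ℕ) = 0 ∨ (t : ℕ) = a + 2 + 1)},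
          bKernel ρ β M (W t.1) (W (t.1 + 1)) := by
    intro v
    -- the free bonds as the image of `Fin (a+2) ⊕ Fin (b'+2)`
    set φ : Fin (a + 2) ⊕ Fin (b' + 2) → {t : Fin (1 + (a + 2 + (b' + 1 + 1)) + 1) // ¬((t : ℕ) = 0 ∨ (t : ℕ) = a + 2 + 1)} :=
      Sum.elim (fun j => ⟨⟨(j : ℕ) + 1, by omega⟩, by simp only [not_or]; constructor <;> omega⟩)
        (fun j => ⟨⟨a + 4 + (j : ℕ), by omega⟩, by simp only [not_or]; constructor <;> omega⟩) with hφ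
    have hφbij : Function.Bijective φ := by
      rw [Fintype.bijective_iff_injective_and_card]
      refine ⟨?_, by rw [hcardC]; simp only [Fintype.card_sum, Fintype.card_fin]; omega⟩
      rintro (j | j) (j' | j') h <;> simp only [hφ, Sum.elim_inl, Sum.elim_inr, Subtype.mk.injEq, Fin.mk.injEq] at h
      · exact congrArg Sum.inl (Fin.ext (by omega))
      · exfalso; omega
      · exfalso; omega
      · exact congrArg Sum.inr (Fin.ext (by omega))
    rw [← Fintype.prod_equiv (Equiv.ofBijective φ hφbij)
      (fun u => Sum.elim
        (fun j : Fin (a + 2) => bKernel ρ β M (Sum.elim W v (es.symm (((j : ℕ) : ℕ) : ZMod m)))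
          (Sum.elim W v (es.symm ((((j : ℕ) + 1 : ℕ)) : ZMod m))))
        (fun j : Fin (b' + 2) => bKernel ρ β M (Sum.elim W v (es.symm ((a + 2 + e + 1 + (j : ℕ) : ℕ) : ZMod m)))
          (Sum.elim W v (es.symm ((a + 2 + e + 2 + (j : ℕ) : ℕ) : ZMod m)))) u)
      (fun t => bKernel ρ β M (W t.1) (W (t.1 + 1))) ?_, Fintype.prod_sum_type]
    · rfl
    · rintro (j | j)
      · simp only [Equiv.ofBijective_apply, hφ, Sum.elim_inl]
        rw [hgap v (j : ℕ) (by omega), hgap v ((j : ℕ) + 1) (by omega)]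
        congr 2
        refine Fin.ext ?_
        rw [Fin.val_add_one_of_lt (Fin.lt_def.2 (by rw [Fin.val_mk, Fin.val_last]; omega))]
      · simp only [Equiv.ofBijective_apply, hφ, Sum.elim_inr]
        rw [hfar v (j : ℕ) (by omega), hfar' v j]
  -- the joined integrand
  have hkey : ∀ v : Fin e ⊕ Fin e → ℕ × HalfCfg S S G,
      F (fun t => Sum.elim W v (es.symm t)) =
        (∏ t : {t : Fin (1 + (a + 2 + (b' + 1 + 1)) + 1) // ¬((t : ℕ) = 0 ∨ (t : ℕ) = a + 2 + 1)}, bKernel ρ β M (W t.1) (W (t.1 + 1))) *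
          (halfBlock ρ β M f (Fin.cons (W 1) (Fin.snoc (fun k => v (Sum.inl k)) (W 0))) *
            halfBlock ρ β M g (Fin.cons (W c3) (Fin.snoc (fun k => v (Sum.inr k)) (W (c3 + 1))))) := by
    intro v
    simp only [hF]
    rw [hfree v, hvL v, hvR v]
  simp_rw [hkey]
  rw [integral_const_mul]
  have hsplit := slab_integral_pi_two_blocks (tMeasure S G Nc β M) (Equiv.refl (Fin e ⊕ Fin e))
    (fun vL : Fin e → ℕ × HalfCfg S S G => halfBlock ρ β M f (Fin.cons (W 1) (Fin.snoc vL (W 0))))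
    (fun vR : Fin e → ℕ × HalfCfg S S G => halfBlock ρ β M g (Fin.cons (W c3) (Fin.snoc vR (W (c3 + 1)))))
  simp only [Equiv.refl_apply] at hsplit
  rw [hsplit]
  -- the heterogeneous bond product on the outer cycle
  rw [← Finset.prod_mul_prod_compl ({0, c3} : Finset (Fin (1 + (a + 2 + (b' + 1 + 1)) + 1))), Finset.prod_pair h0c3,
    Finset.prod_subtype (p := fun t : Fin (1 + (a + 2 + (b' + 1 + 1)) + 1) => ¬((t : ℕ) = 0 ∨ (t : ℕ) = a + 2 + 1))
      (F := inferInstance) _ (fun x => by rw [Finset.mem_compl, hmem])]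
  have hrest : ∏ t : {t : Fin (1 + (a + 2 + (b' + 1 + 1)) + 1) // ¬((t : ℕ) = 0 ∨ (t : ℕ) = a + 2 + 1)},
      (fun i : ℕ => if i = 0 then (fun x y : ℕ × HalfCfg S S G => halfBlockT S G Nc ρ β M f y x)
        else if i = a + 2 + 1 then halfBlockT S G Nc ρ β M g else bKernel ρ β M) (t.1 : ℕ) (W t.1) (W (t.1 + 1)) =
      ∏ t : {t : Fin (1 + (a + 2 + (b' + 1 + 1)) + 1) // ¬((t : ℕ) = 0 ∨ (t : ℕ) = a + 2 + 1)}, bKernel ρ β M (W t.1) (W (t.1 + 1)) :=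
    Fintype.prod_congr _ _ fun t => by
      dsimp only
      rw [if_neg (fun h => t.2 (Or.inl h)), if_neg (fun h => t.2 (Or.inr h))]
  rw [hrest]
  simp only [Fin.val_zero, hvc3, zero_add, if_true, show ¬(a + 2 + 1 = 0) from by omega, if_false, halfBlockT]
  ring

end ShiftedSandwich

end Summit.QuantumFields.YangMills.Cruxes.DiagonalMirrorRPR.SignTwistedDiagonalTrace.WilsonDiagonal

end
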